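import Summits.MatrixMultiplication.MatrixMultiplication.Theorems.FarEdgeDescentSpectralAbundance
import Literature.Computability.AlgebraicComplexity.TensorSemiringSpectrum
import Literature.Computability.AlgebraicComplexity.StrassenPreorderSubrank
import HarnessLib

/-!
# Route `FarEdgeDescent` — Kernel XXII-B «the top edge: compact top fibre, attained exit slope, bluntness»

decomp-mm ROOT cell (D-0178), lens 2 «structural dichotomy: special vs generic», gen 46; Theses-free
(imports `FarEdgeDescentSpectralAbundance` — hence XXI-A/B/C — and `Literature` only; every field `K`;
the generic item text `ALC_K` INLINE).  Cut of record UNCHANGED.  Answers critic g45 s1/s2 (STATUS l.2090)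
and memo NODE-v45 §7.2 with lens 4's tool: the asymptotic spectrum `X(T(K), ≤)` is COMPACT
(`IsStrassenPreorder.isCompact_setOf_isSpectralPoint`, Zuiddam Thm. 2.15) and universal spectral points ARE
its points (`TensorClass.eval` / `TensorClass.spectralMapOf`, CVZ 2023 §1.2).

§1 ATTAINMENT.  `exists_carrier`: EVERY real format `x ≥ 0` is carried — some universal point has
   `θ₁ + x·θ₂ + θ₃ = ω_K(1,x,1)` (XXI-A had rational `x` only); `exists_top_shallowest`: some TOP point
   `φ_*` (`Σθ = ω_K`) MAXIMISES the height `θ₂` over the top fibre — the minimal top depth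
   `σ_K := 1 − θ₂(φ_*)` is attained (`σ_K ∈ (0,1)` when `ω_K > 2`, `top_coord_mem_Ioo`).
§2 THE EXIT SLOPE OF THE PENCIL AT THE SQUARE IS `1 − σ_K` (unconditional, every field; Danskin's rule for
   the support function `x ↦ ω_K(1,x,1) = max_φ ℓ_φ(x)` at `x = 1`): `ω_K + (x−1)(1−σ_K) ≤ ω_K(1,x,1)` for
   all `x ≥ 1` (`omegaRect_ge_exitLine`) and, for every `η > 0`, `ω_K(1,x,1) ≤ ω_K + (x−1)(1−σ_K+η)` on a
   right neighbourhood of `1` (`omegaRect_le_exitLine`, by Cantor intersection in the compact spectrum: a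
   steeper germ would produce top points of height `> 1 − σ_K`).  In excess terms `e'(1⁺) = −σ_K`: the
   typed form of memo §2(d) «`ψ'(0⁺) = −σ`»; and `ω_K = 2 ⟺ σ_K = 0 ⟺` some top point lies on the face
   `θ₂ = 1` (`omega_eq_two_iff_top_on_face`).
§3 THE GENERIC LEAF AT THE TOP EDGE (under `ALC_K` and `ω_K > 2`): the exit line is NEVER touched again
   (`exitLine_lt_omegaRect`: `ω_K + (x−1)(1−σ_K) < ω_K(1,x,1)` for all `x > 1`, top isolation at `φ_*`),
   the best exponential floor `e(x) ≥ τ·exp(−(x−1)σ_K/τ)` holds with THE attained `σ_K`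
   (`excess_ge_exp_floor_sigma`; since the linear terms agree by §2, this is a genuine second-order
   statement: BLUNTNESS `e(x) − (τ − σ_K(x−1)) ≳ σ_K²(x−1)²/(2τ)`), and locally NO FINITE FAMILY of universal
   points carries the formats of `[1, 1+δ]`, for any `δ > 0` (`not_finitelyCarried_near`, critic s2), whence
   infinitely many distinct universal points carry formats in `(1, 1+δ]` (`carriersNear_infinite`).
Dichotomy reading (with XXII-A): SPECIAL = Lipschitz/Hölder regularity of the shadow at its LIGHT corner;
GENERIC = bluntness of the shadow at its TOP corner, whose tangent data `(τ, σ_K)` are attained invariants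
of `K`; `S ⟺ τ = 0 ⟺ σ_K = 0`.

NO definitions (gate rule D-0009).  Nothing here proves `ω = 2`.
References: [cite: Zuiddam2018, Thm. 2.15, Cor. 2.13]; [cite: ChristandlVranaZuiddam2023, §1.2];
[cite: Strassen1988, Thm. 3.8]; [cite: AlmanLi2026, Proposition 4.1, Proposition 4.2];
[cite: LottiRomani1983, Prop. 4.1].
-/

set_option linter.dupNamespace false

noncomputable section

open scoped BigOperators

namespace Summit.MatrixMultiplication.MatrixMultiplication.Theorems.FarEdgeDescentExitSlope

open Literature.Computability.AlgebraicComplexity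
open Summit.MatrixMultiplication.MatrixMultiplication.Theorems.FarEdgeDescentSpectralShadow
open Summit.MatrixMultiplication.MatrixMultiplication.Theorems.FarEdgeDescentSpectralHorn
open Summit.MatrixMultiplication.MatrixMultiplication.Theorems.FarEdgeDescentFieldNode
open Summit.MatrixMultiplication.MatrixMultiplication.Theorems.FarEdgeDescentSpectralAbundance

variable {K : Type} [Field K]

/-! ## §0 The dictionary: universal spectral points = points of the compact spectrum `X(T(K), ≤)` -/

/-- A point of `X(T(K), ≤)` is `≥ 1` on every matrix multiplication class `[⟨n,m,p⟩]`, `n,m,p ≥ 1`.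
[cite: ChristandlVranaZuiddam2023, §1.2] -/
theorem one_le_apply_matMul {φ : TensorClass K → ℝ}
    (hφ : IsSpectralPoint (fun x y : TensorClass K => x ≤ y) φ) {n m p : ℕ} (hn : 1 ≤ n) (hm : 1 ≤ m)
    (hp : 1 ≤ p) : 1 ≤ φ (TensorClass.mk (matMulTensor K n m p)) := by
  have h := (TensorClass.isUniversalSpectralPoint_spectralMapOf hφ).one_le_map_matMulTensor hn hm hp
  rwa [TensorClass.spectralMapOf_apply] at h

/-- `φ ↦ log₂ φ[⟨n,m,p⟩]` is continuous on the spectrum (values `≥ 1`). [cite: Zuiddam2018, Thm. 2.15] -/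
theorem continuousOn_logb_apply {n m p : ℕ} (hn : 1 ≤ n) (hm : 1 ≤ m) (hp : 1 ≤ p) :
    ContinuousOn (fun φ : TensorClass K → ℝ => Real.logb 2 (φ (TensorClass.mk (matMulTensor K n m p))))
      {φ | IsSpectralPoint (fun x y : TensorClass K => x ≤ y) φ} := by
  have h : ContinuousOn (fun φ : TensorClass K → ℝ => Real.log (φ (TensorClass.mk (matMulTensor K n m p))))
      {φ | IsSpectralPoint (fun x y : TensorClass K => x ≤ y) φ} :=
    (continuous_apply _).continuousOn.log fun φ hφ =>
      ne_of_gt (lt_of_lt_of_le one_pos (one_le_apply_matMul hφ hn hm hp))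
  exact h.div_const _

/-- The evaluation of a TOP universal point lies in the top fibre `{φ ∈ X : φ[⟨2,2,2⟩] = 2^{ω_K}}`.
[cite: ChristandlVranaZuiddam2023, §1.2] [cite: AlmanLi2026, Proposition 4.2] -/
theorem eval_mem_topFibre {G : SpectralMap K} (hG : IsUniversalSpectralPoint K G)
    (htop : ∑ i, specMMPoint K G i = omega K) :
    TensorClass.eval G ∈ {φ : TensorClass K → ℝ | IsSpectralPoint (fun x y : TensorClass K => x ≤ y) φ} ∩
      {φ | φ (TensorClass.mk (matMulTensor K 2 2 2)) = (2 : ℝ) ^ omega K} := by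
  refine ⟨TensorClass.isSpectralPoint_eval hG, ?_⟩
  show TensorClass.eval G (TensorClass.mk (matMulTensor K 2 2 2)) = (2 : ℝ) ^ omega K
  rw [TensorClass.eval_mk hG]
  exact (top_iff_cube hG).1 htop

/-! ## §1 Attainment: every real format is carried; the shallowest top point exists -/

/-- **Every real format `x ≥ 0` is carried** (every field): some universal spectral point has
`θ₁ + x·θ₂ + θ₃ = ω_K(1,x,1)` — the supremum in `isLUB_line` is a maximum, by compactness of the spectrum
and continuity of `φ ↦ ℓ_φ(x)`. [cite: Zuiddam2018, Thm. 2.15] [cite: Strassen1988, Thm. 3.8] -/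
theorem exists_carrier {x : ℝ} (hx : 0 ≤ x) :
    ∃ F : SpectralMap K, IsUniversalSpectralPoint K F ∧
      specMMPoint K F 0 + x * specMMPoint K F 1 + specMMPoint K F 2 = omegaRect K 1 x 1 := by
  set X := {φ : TensorClass K → ℝ | IsSpectralPoint (fun x y : TensorClass K => x ≤ y) φ} with hXdef
  have hX : IsCompact X := (TensorClass.isStrassenPreorder K).isCompact_setOf_isSpectralPoint
  -- the continuous functional `φ ↦ ℓ_φ(x)` in log-coordinates
  set g : (TensorClass K → ℝ) → ℝ := fun φ =>
    Real.logb 2 (φ (TensorClass.mk (matMulTensor K 2 1 1))) +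
      x * Real.logb 2 (φ (TensorClass.mk (matMulTensor K 1 2 1))) +
      Real.logb 2 (φ (TensorClass.mk (matMulTensor K 1 1 2))) with hg
  have hgc : ContinuousOn g X :=
    ((continuousOn_logb_apply (K := K) (by norm_num) le_rfl le_rfl).add
      (continuousOn_const.mul (continuousOn_logb_apply (K := K) le_rfl (by norm_num) le_rfl))).add
      (continuousOn_logb_apply (K := K) le_rfl le_rfl (by norm_num))
  -- lines of universal points are values of `g`
  have hline : ∀ G : SpectralMap K, IsUniversalSpectralPoint K G →
      specMMPoint K G 0 + x * specMMPoint K G 1 + specMMPoint K G 2 = g (TensorClass.eval G) := by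
    intro G hG
    simp only [hg, specMMPoint_zero, specMMPoint_one, specMMPoint_two, TensorClass.eval_mk hG]
  obtain ⟨F₀, hF₀, -⟩ := exists_top (K := K)
  obtain ⟨φ, hφX, hmax⟩ := hX.exists_isMaxOn ⟨TensorClass.eval F₀, TensorClass.isSpectralPoint_eval hF₀⟩ hgc
  have hφ := TensorClass.isUniversalSpectralPoint_spectralMapOf hφX
  refine ⟨TensorClass.spectralMapOf φ, hφ, le_antisymm (line_le_omegaRect hφ hx) ?_⟩
  -- `ℓ_{φ}(x)` bounds every line, hence the pencil
  have hval : specMMPoint K (TensorClass.spectralMapOf φ) 0 + x * specMMPoint K (TensorClass.spectralMapOf φ) 1 +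
      specMMPoint K (TensorClass.spectralMapOf φ) 2 = g φ := by
    simp only [hg, specMMPoint_zero, specMMPoint_one, specMMPoint_two, TensorClass.spectralMapOf_apply]
  refine (isLUB_line (K := K) hx).2 ?_
  rintro _ ⟨G, hG, rfl⟩
  show specMMPoint K G 0 + x * specMMPoint K G 1 + specMMPoint K G 2 ≤ _
  rw [hline G hG, hval]
  exact hmax (TensorClass.isSpectralPoint_eval hG)

/-- **The shallowest top point exists** (every field): some universal point with `θ₁+θ₂+θ₃ = ω_K`
maximises `θ₂` among all such points — the minimal top depth `σ_K = 1 − max θ₂` is ATTAINED (the top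
fibre is compact: closed in the compact spectrum). [cite: Zuiddam2018, Thm. 2.15, Cor. 2.13]
[cite: AlmanLi2026, Proposition 4.2] -/
theorem exists_top_shallowest :
    ∃ F : SpectralMap K, IsUniversalSpectralPoint K F ∧ ∑ i, specMMPoint K F i = omega K ∧
      ∀ G : SpectralMap K, IsUniversalSpectralPoint K G → ∑ i, specMMPoint K G i = omega K →
        specMMPoint K G 1 ≤ specMMPoint K F 1 := by
  set X := {φ : TensorClass K → ℝ | IsSpectralPoint (fun x y : TensorClass K => x ≤ y) φ} with hXdef
  have hX : IsCompact X := (TensorClass.isStrassenPreorder K).isCompact_setOf_isSpectralPoint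
  set c := TensorClass.mk (matMulTensor K 2 2 2) with hc
  set a := TensorClass.mk (matMulTensor K 1 2 1) with ha
  have hT : IsCompact (X ∩ {φ | φ c = (2 : ℝ) ^ omega K}) :=
    hX.inter_right (isClosed_eq (continuous_apply c) continuous_const)
  obtain ⟨F₀, hF₀, htop₀⟩ := exists_top (K := K)
  obtain ⟨φ, hφT, hmax⟩ :=
    hT.exists_isMaxOn ⟨TensorClass.eval F₀, eval_mem_topFibre hF₀ htop₀⟩ (continuous_apply a).continuousOn
  have hφ := TensorClass.isUniversalSpectralPoint_spectralMapOf hφT.1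
  refine ⟨TensorClass.spectralMapOf φ, hφ, ?_, fun G hG htopG => ?_⟩
  · rw [top_iff_cube hφ, TensorClass.spectralMapOf_apply]
    exact hφT.2
  · have hle : TensorClass.eval G a ≤ φ a := hmax (eval_mem_topFibre hG htopG)
    rw [ha, TensorClass.eval_mk hG] at hle
    rw [specMMPoint_one, specMMPoint_one, TensorClass.spectralMapOf_apply]
    exact Real.logb_le_logb_of_le one_lt_two
      (lt_of_lt_of_le one_pos (hG.one_le_map_matMulTensor le_rfl (by norm_num) le_rfl)) hle

/-! ## §2 The exit slope of the pencil at the square -/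

/-- **Lower exit line** (every top point; in particular the shallowest): `ω_K + (x−1)·θ₂(φ) ≤ ω_K(1,x,1)`
for `x ≥ 0`. [cite: Strassen1988, Thm. 3.8] -/
theorem omegaRect_ge_exitLine {F : SpectralMap K} (hF : IsUniversalSpectralPoint K F)
    (htop : ∑ i, specMMPoint K F i = omega K) {x : ℝ} (hx : 0 ≤ x) :
    omega K + (x - 1) * specMMPoint K F 1 ≤ omegaRect K 1 x 1 := by
  have h := line_le_omegaRect hF hx
  rw [sum_three] at htop
  linarith

/-- **Upper exit line (Danskin at the square)**: if `s` bounds the height `θ₂` of every TOP point (best: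
`s = θ₂(φ_*) = 1 − σ_K`, `exists_top_shallowest`), then for every `η > 0` there is `x₀ > 1` with
`ω_K(1,x,1) ≤ ω_K + (x−1)·(s + η)` on `[1, x₀]`.  (Otherwise carriers of formats `x ↓ 1` have height
`≥ s + η` and darkness `→ ω_K − 2`; by Cantor intersection in the compact spectrum a TOP point of height
`≥ s + η` would exist.)  With `omegaRect_ge_exitLine`: the right derivative of `x ↦ ω_K(1,x,1)` at `1` is
exactly `1 − σ_K`. [cite: Zuiddam2018, Thm. 2.15] [cite: Strassen1988, Thm. 3.8]
[cite: AlmanLi2026, Proposition 4.1] -/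
theorem omegaRect_le_exitLine {s : ℝ}
    (hmax : ∀ G : SpectralMap K, IsUniversalSpectralPoint K G → ∑ i, specMMPoint K G i = omega K →
      specMMPoint K G 1 ≤ s)
    {η : ℝ} (hη : 0 < η) :
    ∃ x₀ : ℝ, 1 < x₀ ∧ ∀ x : ℝ, 1 ≤ x → x ≤ x₀ → omegaRect K 1 x 1 ≤ omega K + (x - 1) * (s + η) := by
  by_contra hnot
  push Not at hnot
  set X := {φ : TensorClass K → ℝ | IsSpectralPoint (fun x y : TensorClass K => x ≤ y) φ} with hXdef
  have hX : IsCompact X := (TensorClass.isStrassenPreorder K).isCompact_setOf_isSpectralPoint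
  set c := TensorClass.mk (matMulTensor K 2 2 2) with hc
  set a := TensorClass.mk (matMulTensor K 1 2 1) with ha
  -- the decreasing closed sets `V n = X ∩ {φ[⟨1,2,1⟩] ≥ 2^{s+η}} ∩ {φ[⟨2,2,2⟩] ≥ 2^{ω − 1/(n+1)}}`
  set V : ℕ → Set (TensorClass K → ℝ) := fun n =>
    X ∩ ({φ | (2 : ℝ) ^ (s + η) ≤ φ a} ∩ {φ | (2 : ℝ) ^ (omega K - 1 / ((n : ℝ) + 1)) ≤ φ c}) with hV
  have hVcl : ∀ n, IsClosed (V n) := fun n =>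
    hX.isClosed.inter ((isClosed_le continuous_const (continuous_apply a)).inter
      (isClosed_le continuous_const (continuous_apply c)))
  have hVmono : ∀ n, V (n + 1) ⊆ V n := by
    intro n φ hφ
    have h3 : (2 : ℝ) ^ (omega K - 1 / (((n + 1 : ℕ) : ℝ) + 1)) ≤ φ c := hφ.2.2
    refine ⟨hφ.1, hφ.2.1, ?_⟩
    show (2 : ℝ) ^ (omega K - 1 / ((n : ℝ) + 1)) ≤ φ c
    refine le_trans (Real.rpow_le_rpow_of_exponent_le one_le_two ?_) h3
    push_cast
    have h1 : (1 : ℝ) / ((n : ℝ) + 1 + 1) ≤ 1 / ((n : ℝ) + 1) :=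
      one_div_le_one_div_of_le (by positivity) (by linarith)
    linarith
  -- each `V n` is nonempty: a carrier of a bad format `x ∈ (1, 1 + 1/(n+1)]`
  have hVne : ∀ n, (V n).Nonempty := by
    intro n
    have hn1 : (0 : ℝ) < 1 / ((n : ℝ) + 1) := by positivity
    obtain ⟨x, hx1, hxn, hbad⟩ := hnot (1 + 1 / ((n : ℝ) + 1)) (by linarith)
    -- `x > 1`
    have hx : 1 < x := by
      rcases hx1.lt_or_eq with h | h
      · exact h
      · rw [← h, sub_self, zero_mul, add_zero, omegaRect_one_one_one] at hbad
        exact absurd hbad (lt_irrefl _)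
    obtain ⟨G, hG, hcar⟩ := exists_carrier (K := K) (by linarith : (0 : ℝ) ≤ x)
    have hθ := AlmanLi2026.prop42_mem_Icc hG 1
    have hsum := AlmanLi2026.prop42_sum_le_omega hG
    rw [sum_three] at hsum
    have hmono := omegaRect_one_mid_one_mono K hx.le
    rw [omegaRect_one_one_one] at hmono
    -- height `θ₂(G) ≥ s + η` and darkness `Σθ(G) ≥ ω − (x−1) ≥ ω − 1/(n+1)`
    have hheight : s + η ≤ specMMPoint K G 1 := by
      by_contra hlt
      rw [not_le] at hlt
      have : (x - 1) * specMMPoint K G 1 < (x - 1) * (s + η) := mul_lt_mul_of_pos_left hlt (by linarith)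
      linarith
    have hdark : omega K - 1 / ((n : ℝ) + 1) ≤ specMMPoint K G 0 + specMMPoint K G 1 + specMMPoint K G 2 := by
      have : (x - 1) * specMMPoint K G 1 ≤ (x - 1) * 1 := mul_le_mul_of_nonneg_left hθ.2 (by linarith)
      linarith
    refine ⟨TensorClass.eval G, TensorClass.isSpectralPoint_eval hG, ?_, ?_⟩
    · show (2 : ℝ) ^ (s + η) ≤ TensorClass.eval G a
      rw [ha, TensorClass.eval_mk hG, hG.map_matMulTensor_line₂ (by norm_num : 1 ≤ 2), Nat.cast_ofNat]
      exact Real.rpow_le_rpow_of_exponent_le one_le_two hheight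
    · show (2 : ℝ) ^ (omega K - 1 / ((n : ℝ) + 1)) ≤ TensorClass.eval G c
      rw [hc, TensorClass.eval_mk hG, hG.map_matMulTensor_cube (by norm_num : 1 ≤ 2), Nat.cast_ofNat,
        sum_three]
      exact Real.rpow_le_rpow_of_exponent_le one_le_two hdark
  -- Cantor: a point in every `V n`
  have hV0 : IsCompact (V 0) := hX.inter_right ((isClosed_le continuous_const (continuous_apply a)).inter
      (isClosed_le continuous_const (continuous_apply c)))
  obtain ⟨φ, hφ⟩ := IsCompact.nonempty_iInter_of_sequence_nonempty_isCompact_isClosed V hVmono hVne hV0 hVcl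
  rw [Set.mem_iInter] at hφ
  have hφX : φ ∈ X := (hφ 0).1
  have hψ := TensorClass.isUniversalSpectralPoint_spectralMapOf hφX
  set G := TensorClass.spectralMapOf φ with hGdef
  have hGa : G (matMulTensor K 1 2 1) = φ a := by rw [hGdef, TensorClass.spectralMapOf_apply]
  have hGc : G (matMulTensor K 2 2 2) = φ c := by rw [hGdef, TensorClass.spectralMapOf_apply]
  -- `G` is top
  have hsumle := AlmanLi2026.prop42_sum_le_omega hψ
  have htopG : ∑ i, specMMPoint K G i = omega K := by
    refine le_antisymm hsumle (le_of_forall_pos_lt_add fun δ hδ => ?_)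
    obtain ⟨n, hn⟩ := exists_nat_one_div_lt hδ
    have h2 : (2 : ℝ) ^ (omega K - 1 / ((n : ℝ) + 1)) ≤ φ c := (hφ n).2.2
    rw [← hGc, hψ.map_matMulTensor_cube (by norm_num : 1 ≤ 2), Nat.cast_ofNat,
      Real.rpow_le_rpow_left_iff one_lt_two] at h2
    linarith
  -- but its height exceeds the maximum
  have hha : (2 : ℝ) ^ (s + η) ≤ φ a := (hφ 0).2.1
  rw [← hGa, hψ.map_matMulTensor_line₂ (by norm_num : 1 ≤ 2), Nat.cast_ofNat,
    Real.rpow_le_rpow_left_iff one_lt_two] at hha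
  have := hmax G hψ htopG
  linarith

/-- **`ω_K = 2 ⟺` a top point lies on the face `θ₂ = 1`** (`⟺ σ_K = 0`): `⟸` faces are light
(`light_of_coord_eq_one`); `⟹` the carrier of any format `x > 1` has `θ₂ = 1` when `e ≡ 0`.
[cite: LottiRomani1983, Prop. 4.1] [cite: AlmanLi2026, Proposition 4.2] -/
theorem omega_eq_two_iff_top_on_face :
    omega K = 2 ↔ ∃ F : SpectralMap K, IsUniversalSpectralPoint K F ∧
      ∑ i, specMMPoint K F i = omega K ∧ specMMPoint K F 1 = 1 := by
  constructor
  · intro h2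
    obtain ⟨F, hF, hcar⟩ := exists_carrier (K := K) (by norm_num : (0 : ℝ) ≤ 2)
    have hθ := AlmanLi2026.prop42_mem_Icc hF
    have hsum := AlmanLi2026.prop42_sum_le_omega hF
    have hsum2 := AlmanLi2026.prop42_two_le_sum hF
    rw [sum_three] at hsum hsum2
    rw [excess_eq_zero_of_omega_eq_two h2 (by norm_num : (1 : ℝ) ≤ 2)] at hcar
    have h1 : specMMPoint K F 1 = 1 := by
      have := (hθ 1).2
      linarith
    refine ⟨F, hF, ?_, h1⟩
    rw [sum_three]
    linarith
  · rintro ⟨F, hF, htop, h1⟩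
    rw [← htop, light_of_coord_eq_one hF 1 h1]

/-! ## §3 The generic leaf at the top edge -/

/-- **The exit line is never touched again** (under `ALC_K`, `ω_K > 2`): for the shallowest top point
`φ_*` and every real `x > 1`, `ω_K + (x−1)·θ₂(φ_*) < ω_K(1,x,1)` — top isolation (XXI-B) at `φ_*`; with
§2 the pencil is tangent to, and strictly above, its exit line. [cite: LottiRomani1983, Prop. 4.1]
[cite: Strassen1988, Thm. 3.8] -/
theorem exitLine_lt_omegaRect
    (hA : ∀ m : ℝ, 1 < m →
      (omegaRect K 1 m 1 - (m + 1)) ^ 2 ≤ (omegaRect K 1 1 1 - 2) * (omegaRect K 1 (2 * m - 1) 1 - 2 * m))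
    (hω : 2 < omega K) {F : SpectralMap K} (hF : IsUniversalSpectralPoint K F)
    (htop : ∑ i, specMMPoint K F i = omega K) {x : ℝ} (hx : 1 < x) :
    omega K + (x - 1) * specMMPoint K F 1 < omegaRect K 1 x 1 := by
  have h := top_isolated hA hω hF htop hx
  rw [sum_three] at htop
  linarith

/-- **The best exponential floor** (under `ALC_K`, `ω_K > 2`): with the ATTAINED minimal top depth
`σ_K = 1 − θ₂(φ_*)`, `e(x) ≥ τ·exp(−(x−1)σ_K/τ)` for all real `x ≥ 1`, and `σ_K ∈ (0,1)`; by §2 the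
linear parts agree, so the floor bounds the CURVATURE of the excess at the square from below (bluntness).
[cite: Strassen1988, Thm. 3.8] [cite: LottiRomani1983, Prop. 4.1] [cite: Zuiddam2018, Thm. 2.15] -/
theorem excess_ge_exp_floor_sigma
    (hA : ∀ m : ℝ, 1 < m →
      (omegaRect K 1 m 1 - (m + 1)) ^ 2 ≤ (omegaRect K 1 1 1 - 2) * (omegaRect K 1 (2 * m - 1) 1 - 2 * m))
    (hω : 2 < omega K) :
    ∃ σ : ℝ, 0 < σ ∧ σ < 1 ∧
      (∃ F : SpectralMap K, IsUniversalSpectralPoint K F ∧ ∑ i, specMMPoint K F i = omega K ∧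
        specMMPoint K F 1 = 1 - σ ∧
        ∀ G : SpectralMap K, IsUniversalSpectralPoint K G → ∑ i, specMMPoint K G i = omega K →
          σ ≤ 1 - specMMPoint K G 1) ∧
      ∀ x : ℝ, 1 ≤ x →
        (omega K - 2) * Real.exp (-((x - 1) * σ / (omega K - 2))) ≤ omegaRect K 1 x 1 - (x + 1) := by
  obtain ⟨F, hF, htop, hmax⟩ := exists_top_shallowest (K := K)
  have hIoo := top_coord_mem_Ioo hω hF htop 1
  refine ⟨1 - specMMPoint K F 1, by linarith [hIoo.2], by linarith [hIoo.1],
    ⟨F, hF, htop, by ring, fun G hG htopG => by linarith [hmax G hG htopG]⟩, fun x hx => ?_⟩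
  exact excess_ge_exp_floor hA hω hF htop hx

/-- **Locally not finitely carried** (critic g45 s2; under `ALC_K`, `ω_K > 2`): for every `δ > 0`, NO
finite family of universal points carries all formats `x ∈ [1, 1+δ]` — the germ of the pencil at the
square is not finitely generated. [cite: Strassen1988, Thm. 3.8] [cite: LottiRomani1983, Prop. 4.1] -/
theorem not_finitelyCarried_near
    (hA : ∀ m : ℝ, 1 < m →
      (omegaRect K 1 m 1 - (m + 1)) ^ 2 ≤ (omegaRect K 1 1 1 - 2) * (omegaRect K 1 (2 * m - 1) 1 - 2 * m))
    (hω : 2 < omega K) {δ : ℝ} (hδ : 0 < δ) (P : Finset (SpectralMap K))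
    (hP : ∀ F ∈ P, IsUniversalSpectralPoint K F) :
    ¬ ∀ x : ℝ, 1 ≤ x → x ≤ 1 + δ → ∃ F ∈ P,
        specMMPoint K F 0 + x * specMMPoint K F 1 + specMMPoint K F 2 = omegaRect K 1 x 1 := by
  intro hgen
  set P' := P.filter (fun F => ∑ i, specMMPoint K F i < omega K) with hP'
  have hgap : ∃ g : ℝ, 0 < g ∧ ∀ F ∈ P', (∑ i, specMMPoint K F i) ≤ omega K - g := by
    by_cases hne : P'.Nonempty
    · refine ⟨omega K - P'.sup' hne (fun F => ∑ i, specMMPoint K F i), ?_, fun F hF => ?_⟩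
      · obtain ⟨F, hF, hmaxF⟩ := Finset.exists_mem_eq_sup' hne (fun F => ∑ i, specMMPoint K F i)
        rw [hmaxF]
        have := (Finset.mem_filter.1 hF).2
        linarith
      · have := Finset.le_sup' (fun F => ∑ i, specMMPoint K F i) hF
        linarith
    · exact ⟨1, one_pos, fun F hF => absurd ⟨F, hF⟩ hne⟩
  obtain ⟨g, hg, hgap⟩ := hgap
  -- the format `x = 1 + min(g/2, δ)`
  set x : ℝ := 1 + min (g / 2) δ with hxdef
  have hmin : 0 < min (g / 2) δ := lt_min (by linarith) hδ
  have hx1 : 1 < x := by rw [hxdef]; linarith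
  have hxδ : x ≤ 1 + δ := by rw [hxdef]; linarith [min_le_right (g / 2) δ]
  obtain ⟨F, hFP, hcar⟩ := hgen x hx1.le hxδ
  have hF := hP F hFP
  have hmono := omegaRect_one_mid_one_mono K hx1.le
  rw [omegaRect_one_one_one, ← hcar] at hmono
  have hθ := (AlmanLi2026.prop42_mem_Icc hF 1).2
  have htop : ∑ i, specMMPoint K F i = omega K := by
    refine le_antisymm (AlmanLi2026.prop42_sum_le_omega hF) ?_
    by_contra hlt
    rw [not_le] at hlt
    have h1 := hgap F (Finset.mem_filter.2 ⟨hFP, hlt⟩)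
    rw [sum_three] at h1
    have h2 : (x - 1) * specMMPoint K F 1 ≤ g / 2 := by
      have h3 : (x - 1) * specMMPoint K F 1 ≤ (x - 1) * 1 := mul_le_mul_of_nonneg_left hθ (by linarith)
      have h4 : x - 1 ≤ g / 2 := by rw [hxdef]; linarith [min_le_left (g / 2) δ]
      linarith
    nlinarith
  exact (top_isolated hA hω hF htop hx1).ne hcar

/-- **Infinitely many carriers near the square** (under `ALC_K`, `ω_K > 2`): for every `δ > 0` the set of
universal points carrying some format `x ∈ (1, 1+δ]` is INFINITE (every real format is carried, §1, and
no finite family suffices). [cite: Zuiddam2018, Thm. 2.15] [cite: LottiRomani1983, Prop. 4.1] -/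
theorem carriersNear_infinite
    (hA : ∀ m : ℝ, 1 < m →
      (omegaRect K 1 m 1 - (m + 1)) ^ 2 ≤ (omegaRect K 1 1 1 - 2) * (omegaRect K 1 (2 * m - 1) 1 - 2 * m))
    (hω : 2 < omega K) {δ : ℝ} (hδ : 0 < δ) :
    Set.Infinite {F : SpectralMap K | IsUniversalSpectralPoint K F ∧ ∃ x : ℝ, 1 < x ∧ x ≤ 1 + δ ∧
      specMMPoint K F 0 + x * specMMPoint K F 1 + specMMPoint K F 2 = omegaRect K 1 x 1} := by
  classical
  intro hfin
  obtain ⟨F₁, hF₁, htop₁⟩ := exists_top (K := K)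
  -- the finite family: all near carriers, plus a top point for `x = 1`
  refine not_finitelyCarried_near hA hω hδ (insert F₁ hfin.toFinset) ?_ ?_
  · intro F hF
    rcases Finset.mem_insert.1 hF with h | h
    · rw [h]; exact hF₁
    · exact ((Set.Finite.mem_toFinset hfin).1 h).1
  · intro x hx1 hxδ
    rcases hx1.lt_or_eq with hlt | heq
    · obtain ⟨G, hG, hcar⟩ := exists_carrier (K := K) (by linarith : (0 : ℝ) ≤ x)
      exact ⟨G, Finset.mem_insert_of_mem ((Set.Finite.mem_toFinset hfin).2 ⟨hG, x, hlt, hxδ, hcar⟩), hcar⟩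
    · refine ⟨F₁, Finset.mem_insert_self _ _, ?_⟩
      rw [← heq, one_mul, ← sum_three, htop₁, omegaRect_one_one_one]

end Summit.MatrixMultiplication.MatrixMultiplication.Theorems.FarEdgeDescentExitSlope

end
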